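import Summits.Ventures.DiscreteObjects.Mahler.Height1CensusData46

/-!
# Computable coefficient-list arithmetic for the kernel census (venture `DiscreteObjects`, target L)

Cell `pub-namedobj`, seat `pub-namedobj-mahler-g12`. Framing: lottery ticket; floor = certified bounds/negative
ranges.

The census theorems of degrees `6, 8, 10` (`CensusKernelDeg*.lean`) are proved by an exhaustive search that the
kernel itself runs (`decide` with kernel reduction; standard axioms only). This file supplies the list-level
polynomial arithmetic that search evaluates, each operation with the lemma identifying it with the corresponding
operation on `ofCoeffs` (ascending coefficient lists, `SmallMeasureCensus`):

* `ofCoeffs_nil`, `ofCoeffs_cons` (and `coeff_ofCoeffs` from `Height1CensusData46`), degree and monicity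
  from the list (`natDegree_ofCoeffs_eq`, `monic_ofCoeffs`);
* `lpAdd`, `lpNeg`, `lpSMul`, `lpMul` (sum, negation, scalar multiple, product), `lpNegAlt` (`P(-x)`),
  `lpExpand2` (`P(x²)`), `lpXPowSubOne m` (`x^m - 1`);
* `lpIsZero` / `lpEq`: a Boolean test with `lpEq l m = true → ofCoeffs l = ofCoeffs m`.
-/

namespace Summit.Ventures.DiscreteObjects.Mahler

open Polynomial

/-! ## `ofCoeffs`: structural lemmas -/

/-- `ofCoeffs [] = 0`. -/
theorem ofCoeffs_nil : ofCoeffs [] = 0 := by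
  simp [ofCoeffs]

/-- Shifting the index offset of `zipIdx` multiplies the represented polynomial by `x`. -/
private theorem zipIdx_sum_succ (l : List ℤ) (k : ℕ) :
    ((l.zipIdx (k + 1)).map fun ai : ℤ × ℕ => C ai.1 * X ^ ai.2).sum =
      X * ((l.zipIdx k).map fun ai : ℤ × ℕ => C ai.1 * X ^ ai.2).sum := by
  induction l generalizing k with
  | nil => simp
  | cons a l ih =>
    rw [List.zipIdx_cons, List.zipIdx_cons, List.map_cons, List.map_cons, List.sum_cons, List.sum_cons,
      ih (k + 1), mul_add, pow_succ]
    ring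

/-- `ofCoeffs (a :: l) = x · ofCoeffs l + a` (stated with the constant last: the `ofCoeffs` here is the
`zipIdx`-based one of `SmallMeasureCensus`, not the recursive namesakes elsewhere in the tree). -/
theorem ofCoeffs_cons (a : ℤ) (l : List ℤ) : ofCoeffs (a :: l) = X * ofCoeffs l + C a := by
  unfold ofCoeffs
  rw [List.zipIdx_cons, List.map_cons, List.sum_cons, zipIdx_sum_succ, pow_zero, mul_one, add_comm]

-- `coeff_ofCoeffs : (ofCoeffs l).coeff i = l.getD i 0` is `Height1CensusData46.coeff_ofCoeffs` (imported).

/-- If `l` has length `n + 1` and last entry nonzero then `deg (ofCoeffs l) = n`. -/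
theorem natDegree_ofCoeffs_eq {l : List ℤ} {n : ℕ} (hlen : l.length = n + 1) (hlast : l.getD n 0 ≠ 0) :
    (ofCoeffs l).natDegree = n := by
  apply le_antisymm
  · rw [natDegree_le_iff_coeff_eq_zero]
    intro N hN
    rw [coeff_ofCoeffs]
    exact List.getD_eq_default _ _ (by omega)
  · apply le_natDegree_of_ne_zero; rw [coeff_ofCoeffs]; exact hlast

/-- If `l` has length `n + 1` and last entry `1` then `ofCoeffs l` is monic of degree `n`. -/
theorem monic_ofCoeffs {l : List ℤ} {n : ℕ} (hlen : l.length = n + 1) (hlast : l.getD n 0 = 1) :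
    (ofCoeffs l).Monic ∧ (ofCoeffs l).natDegree = n := by
  have hdeg := natDegree_ofCoeffs_eq hlen (by rw [hlast]; exact one_ne_zero)
  refine ⟨?_, hdeg⟩
  rw [Monic, leadingCoeff, hdeg, coeff_ofCoeffs, hlast]

/-! ## List arithmetic -/

/-- Coefficientwise sum (the longer tail is kept). -/
def lpAdd : List ℤ → List ℤ → List ℤ
  | [], m => m
  | a :: l, [] => a :: l
  | a :: l, b :: m => (a + b) :: lpAdd l m

/-- `ofCoeffs (lpAdd l m) = ofCoeffs l + ofCoeffs m`. -/
theorem ofCoeffs_lpAdd (l m : List ℤ) : ofCoeffs (lpAdd l m) = ofCoeffs l + ofCoeffs m := by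
  induction l generalizing m with
  | nil => simp [lpAdd, ofCoeffs_nil]
  | cons a l ih =>
    cases m with
    | nil => simp [lpAdd, ofCoeffs_nil]
    | cons b m => rw [lpAdd, ofCoeffs_cons, ofCoeffs_cons, ofCoeffs_cons, ih, C_add]; ring

/-- Negation. -/
def lpNeg (l : List ℤ) : List ℤ := l.map fun x => -x

/-- `ofCoeffs (lpNeg l) = - ofCoeffs l`. -/
theorem ofCoeffs_lpNeg (l : List ℤ) : ofCoeffs (lpNeg l) = -ofCoeffs l := by
  induction l with
  | nil => simp [lpNeg, ofCoeffs_nil]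
  | cons a l ih =>
    have h : lpNeg (a :: l) = (-a) :: lpNeg l := rfl
    rw [h, ofCoeffs_cons, ofCoeffs_cons, ih, C_neg]; ring

/-- Scalar multiple. -/
def lpSMul (c : ℤ) (l : List ℤ) : List ℤ := l.map fun x => c * x

/-- `ofCoeffs (lpSMul c l) = c · ofCoeffs l`. -/
theorem ofCoeffs_lpSMul (c : ℤ) (l : List ℤ) : ofCoeffs (lpSMul c l) = C c * ofCoeffs l := by
  induction l with
  | nil => simp [lpSMul, ofCoeffs_nil]
  | cons a l ih =>
    have h : lpSMul c (a :: l) = (c * a) :: lpSMul c l := rfl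
    rw [h, ofCoeffs_cons, ofCoeffs_cons, ih, C_mul]; ring

/-- Product (schoolbook). -/
def lpMul : List ℤ → List ℤ → List ℤ
  | [], _ => []
  | a :: l, m => lpAdd (lpSMul a m) (0 :: lpMul l m)

/-- `ofCoeffs (lpMul l m) = ofCoeffs l * ofCoeffs m`. -/
theorem ofCoeffs_lpMul (l m : List ℤ) : ofCoeffs (lpMul l m) = ofCoeffs l * ofCoeffs m := by
  induction l with
  | nil => simp [lpMul, ofCoeffs_nil]
  | cons a l ih =>
    rw [lpMul, ofCoeffs_lpAdd, ofCoeffs_lpSMul, ofCoeffs_cons, ofCoeffs_cons, ih, C_0]; ring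

/-- `P(-x)` on lists: negate the odd-index entries. -/
def lpNegAlt : List ℤ → List ℤ
  | [] => []
  | a :: l => a :: lpNeg (lpNegAlt l)

/-- `ofCoeffs (lpNegAlt l) = (ofCoeffs l)(-x)`. -/
theorem ofCoeffs_lpNegAlt (l : List ℤ) : ofCoeffs (lpNegAlt l) = (ofCoeffs l).comp (-X) := by
  induction l with
  | nil => simp [lpNegAlt, ofCoeffs_nil]
  | cons a l ih =>
    rw [lpNegAlt, ofCoeffs_cons, ofCoeffs_lpNeg, ih, ofCoeffs_cons, add_comp, C_comp, mul_comp, X_comp]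
    ring

/-- `P(x²)` on lists: interleave zeros. -/
def lpExpand2 : List ℤ → List ℤ
  | [] => []
  | a :: l => a :: 0 :: lpExpand2 l

/-- `ofCoeffs (lpExpand2 l) = (ofCoeffs l)(x²)`. -/
theorem ofCoeffs_lpExpand2 (l : List ℤ) : ofCoeffs (lpExpand2 l) = (ofCoeffs l).comp (X ^ 2) := by
  induction l with
  | nil => simp [lpExpand2, ofCoeffs_nil]
  | cons a l ih =>
    rw [lpExpand2, ofCoeffs_cons, ofCoeffs_cons, ih, ofCoeffs_cons, add_comp, C_comp, mul_comp, X_comp, C_0]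
    ring

/-- `x^m - 1` as a list (`m ≥ 1`). -/
def lpXPowSubOne (m : ℕ) : List ℤ := (-1) :: (List.replicate (m - 1) 0 ++ [1])

/-- `ofCoeffs (0,…,0,1) = x^k` (`k` zeros). -/
private theorem ofCoeffs_replicate_zero_append_one (k : ℕ) :
    ofCoeffs (List.replicate k 0 ++ [1]) = X ^ k := by
  induction k with
  | zero => rw [List.replicate_zero, List.nil_append, ofCoeffs_cons, ofCoeffs_nil]; simp
  | succ k ih => rw [List.replicate_succ, List.cons_append, ofCoeffs_cons, ih, C_0, add_zero, pow_succ']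

/-- `ofCoeffs (lpXPowSubOne m) = x^m - 1` for `m ≥ 1`. -/
theorem ofCoeffs_lpXPowSubOne {m : ℕ} (hm : 1 ≤ m) : ofCoeffs (lpXPowSubOne m) = X ^ m - 1 := by
  rw [lpXPowSubOne, ofCoeffs_cons, ofCoeffs_replicate_zero_append_one, ← pow_succ', C_neg, C_1,
    show m - 1 + 1 = m by omega]
  ring

/-- All entries zero? -/
def lpIsZero (l : List ℤ) : Bool := l.all fun x => x == 0

/-- `lpIsZero l → ofCoeffs l = 0`. -/
theorem ofCoeffs_eq_zero_of_lpIsZero {l : List ℤ} (h : lpIsZero l = true) : ofCoeffs l = 0 := by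
  induction l with
  | nil => exact ofCoeffs_nil
  | cons a l ih =>
    simp only [lpIsZero, List.all_cons, Bool.and_eq_true, beq_iff_eq] at h
    rw [ofCoeffs_cons, h.1, ih (by simpa [lpIsZero] using h.2), C_0]; ring

/-- Boolean equality test of the represented polynomials (insensitive to trailing zeros). -/
def lpEq (l m : List ℤ) : Bool := lpIsZero (lpAdd l (lpNeg m))

/-- `lpEq l m → ofCoeffs l = ofCoeffs m`. -/
theorem ofCoeffs_eq_of_lpEq {l m : List ℤ} (h : lpEq l m = true) : ofCoeffs l = ofCoeffs m := by
  have h1 := ofCoeffs_eq_zero_of_lpIsZero h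
  rw [ofCoeffs_lpAdd, ofCoeffs_lpNeg] at h1
  linear_combination h1

end Summit.Ventures.DiscreteObjects.Mahler
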